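import Summits.ABC.ABC.Theses.DefiniteXi
import Summits.ABC.ABC.Theorems.DefiniteXiXiStrongBoundAllTamExp
import Summits.ABC.ABC.Theorems.DefiniteXiSteinbergCoreSplit
import HarnessLib

/-!
# Line `p6-tamagawa-split` — crux `SteinbergCore` (stmt-ABC-15024, route ABC/DefiniteXi)

Skeleton registered by the crux-strategist seat (planner-cstrat-stmt-ABC-15024-p1-0, 2026-08-17) after the crux chain was
declared exhausted.  It is the TYPED DECOMPOSITION of the crux recommended unanimously by TRIAGE-r1-1/2/3 and r2-1/2 and
documented in `Cruxes/SteinbergCore/STRATEGY-CENSUS.md` (§Decomposition), delivered as a line because `route edit --split` is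
reserved to a seat's final cycle: the three stubs are VERBATIM the three children of the prepared split (`children.json`, item
evidence), and `SteinbergCore_of` is verbatim the glue `Summit.ABC.ABC.Theorems.steinbergCore_of_subs` of
`Cruxes/SteinbergCore/SplitGlue.lean` (to be landed as `Theorems/DefiniteXiSteinbergCoreSplit.lean`).

Crux B: `cps ξ(E;N/Nm,Nm) · T(E_(a,b)) ≤ C_ε N^(2+ε)` for every admissible `Nm` (`cps` = prime-to-6 part, `T = ∏_{q∣N} v_q(Δ_min)`).

* `stub_xiDegreeComparison` — KNOWN IN PRINT (formal debt): `ξ ≠ 0 → ∃ D minimal, cps ξ ≤ C_ε N^ε · cps(D.deg) · T³`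
  (Takahashi 2001 Thm 2.3 on `X_r(J₀^{D'}(M'))`; Ribet–Takahashi 1997 Thm 2 = Pasten 2024 Prop 6.13; `i, j ∣` component orders,
  Pasten L. 6.8; optimal-quotient factorisation; JL existence).  Valid at composite `Nm`, on-level primes and the corner `N/Nm = 2^k`
  — the slack `N^ε T³` is exactly what is print (the exact comparison is not: cokernels `j_p`, Pasten Thm 6.17 / Hamidi 2026).
  Its prime-type instance is one `--supports` away from the tree fact `takahashi2001_thm_2_3`.
* `stub_primeToSixDegreeBound` — the abc-STRENGTH ATOM (load-bearing, Brandt-free): `cps(D.deg) ≤ C_ε N^(2+ε)` for minimal data —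
  Frey's degree conjecture away from `6`; ⟸ `FreyDegreeBound ∧ FreyModularity`; no mechanism short of Szpiro on Frey curves is
  known (census §Transfer/§Strengthen/§Negation).
* `stub_abcValuationProduct` — SHARED MILESTONE, verbatim stmt-ABC-1567 (`RibetTakahashiSplit.AbcValuationProduct`): closes by the
  landed `abcValuationProduct_of_many_few` from that route's cruxes; NOT to be attacked inside this line.
* `SteinbergCore_of` — PROVED: `cps ξ · T ≤ C₀ N^{ε/4} cps(deg) T⁴ ≤ C₀ C₁ C₂⁴ N^(2+ε)` (T-child converted by the landed
  `stub_allTamExp_of_valuationProduct`; `ξ = 0` branch has left side `0`).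
Lead (prover-line-stmt-ABC-15024-c1-0), cycle 1: glue landed (p137293) and imported; `SteinbergCore_of` is now the
landed constant; stubs unchanged.  The PRIME-TYPE instance of stub 1 is landed as the registered helper
`Summit.ABC.ABC.Theorems.xiDegreeComparison_prime_of_facts` (p137891, Theorems/DefiniteXiSteinbergCoreXiDegreeComparisonPrime.lean),
conditional on `takahashi2001_thm_2_3_of_coprime`, `PastenShimura2024_minimalDegree_le_163_mul`, `PastenShimura2024_lemma_6_8`
and the route item `FreyModularity`; it does not discharge the ∀-Nm stub.  The COMPOSITE-`Nm` instance is landed as the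
registered helper `Summit.ABC.ABC.Theorems.xiDegreeComparison_of_facts` (p139336,
Theorems/DefiniteXiSteinbergCoreXiDegreeComparison.lean): the full stub signature conditional on Takahashi 2001 Thm 2.3 for the
Shimura curves `X₀^D(M)` (level side `hTlev` / discriminant side `hT2` — verbatim the section hypotheses of
`Literature/NumberTheory/Automorphic/ShimuraCurveRibetTakahashiBrandtCoordinatesProofs.lean`, NOT yet named facts of the tree),
`PastenShimura2024_lemma_6_8`, `nonempty_shimuraParametrizationData` (Jacquet–Langlands data) and `FreyModularity`, in the
sharper form `cps ξ ≤ 163^{ω(Nm)} · ∏_{q ∣ Nm} v_q(Δ_min E) · cps(deg D)` (no `N/Nm = 2^k` corner).  So stub 1 is CLOSED MODULO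
NAMED/UNFILED FACTS; the lead deliberately does not file the two Shimura-curve facts inline (that would pull an XL dependency
into the route's cone for a generality `closes` does not consume — planner's call: re-cut child 1 to prime type, or accept it).
Disproof.lean honoured: §C Tamagawa lock = stub 3 made explicit; §C Takahashi lock = stub 2 without the one-exponent slack (the slack
sits in stub 1 where it is print); §D `0 < ε` kept in every stub; §B junk branch handled in the glue.Lead c2 (prover-line-stmt-ABC-15024-c2-0): thesis calibration landed (p160000, Theorems/DefiniteXiSteinbergCoreThesisCalibration.lean:
stub 3 ⟸ PolyFreyDegree; `SteinbergCore ⟺ FreyDegreeBound` modulo EisensteinQuarantine + DefiniteRTControlPrime + FreyModularity and, for ⟸,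
hTlev/hT2 + L.6.8 + JL); verdict promote-stub (stub 2).  Lead c3 (prover-line-stmt-ABC-15024-c3-0, re-audit HONEST-BET seat), cycle 1:
stubs unchanged (3 sorries); landed `--supports`: p162272 Theorems/DefiniteXiSteinbergCoreXiDegreeComparisonItems.lean (stub 1 REWIRED over
route items: prime type modulo the ONE Literature fact `takahashi2001_thm_2_3_of_coprime` + MazurKenkuBound + IsogenyValuationTransport +
FreyModularity; ∀-Nm form + hTlev/hT2/JL; worker W1 `stub-blocked: takahashi2001_thm_2_3_of_coprime`), p162616
Theorems/DefiniteXiSteinbergCorePrimeRung.lean (PRIME-RUNG package: `B → B♭`, `A → A♭`, `A♭ ∧ B♭ ⟹ prime XiStrongBound`, recut deciding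
chain `abc_of_primeRungs : A♭ → B♭ → DefiniteRTControlPrime → FreyModularity → MinimalBoundGivesTarget → PeterssonLowerBound →
DegreeBoundToABCOfPetersson → ABC` without DefiniteGlue, prime-type split glue `primeRung_of_subs_frey`, calibration `B♭ ⟺ FreyDegreeBound`
modulo that one fact + r9 items + A♭), p162897 Theorems/DefiniteXiSteinbergCorePrimeToSixMinimality.lean and p163062
Theorems/DefiniteXiSteinbergCorePrimeToSixEpsPos.lean (tests for stub 2: the minimality guard and `0 < ε` are LOAD-BEARING modulo
FreyModularity — `[m] ∘ φ` is a datum of degree m²·deg; ε = −3 vs cps ≥ 1 on unbounded conductors).  Stub 2 remains the abc atom.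
-/

set_option linter.dupNamespace false

namespace Summit.ABC.ABC.Cruxes.SteinbergCore.P6TamagawaSplit

open Literature.NumberTheory.EllipticCurves Literature.NumberTheory.Automorphic
open Literature.NumberTheory.EllipticCurves.ModularForms

noncomputable section

/-- **Stub 1 — definite comparison away from 6, with slack** (known in print, formal debt; child `XiDegreeComparison`). -/
theorem stub_xiDegreeComparison :
    ∀ ε : ℝ, 0 < ε → ∃ C : ℝ, ∀ a b : ℤ, IsCoprime a b → a * b * (a + b) ≠ 0 → ∀ (N : ℕ) [NeZero N],
      (Literature.NumberTheory.EllipticCurves.freyCurve a b).conductorNorm ℤ = N →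
      ∀ Nm : ℕ, Odd Nm → Squarefree Nm → Odd Nm.primeFactors.card → Nm ∣ N →
      Literature.NumberTheory.Automorphic.brandtXi (N / Nm) Nm
          (fun n => (Literature.NumberTheory.EllipticCurves.freyCurve a b).LFunction n) ≠ 0 →
      ∃ D : Literature.NumberTheory.EllipticCurves.ModularForms.ModularParametrizationData
        (Literature.NumberTheory.EllipticCurves.freyCurve a b) N,
        (∀ D' : Literature.NumberTheory.EllipticCurves.ModularForms.ModularParametrizationData
          (Literature.NumberTheory.EllipticCurves.freyCurve a b) N, D.deg ≤ D'.deg) ∧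
        ((Literature.NumberTheory.Automorphic.brandtXi (N / Nm) Nm
              (fun n => (Literature.NumberTheory.EllipticCurves.freyCurve a b).LFunction n) /
            (ordProj[2] (Literature.NumberTheory.Automorphic.brandtXi (N / Nm) Nm
                (fun n => (Literature.NumberTheory.EllipticCurves.freyCurve a b).LFunction n)) *
              ordProj[3] (Literature.NumberTheory.Automorphic.brandtXi (N / Nm) Nm
                (fun n => (Literature.NumberTheory.EllipticCurves.freyCurve a b).LFunction n))) : ℕ) : ℝ) ≤
          C * (N : ℝ) ^ ε * ((D.deg / (ordProj[2] D.deg * ordProj[3] D.deg) : ℕ) : ℝ) *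
            ((∏ q ∈ N.primeFactors, ((Literature.NumberTheory.EllipticCurves.freyCurve a b).minimalDiscriminantNorm
              ℤ).factorization q : ℕ) : ℝ) ^ 3 := by
  sorry

/-- **Stub 2 — Frey's degree conjecture away from 6 for minimal data** (abc-strength atom; child `PrimeToSixDegreeBound`). -/
theorem stub_primeToSixDegreeBound :
    ∀ ε : ℝ, 0 < ε → ∃ C : ℝ, ∀ a b : ℤ, IsCoprime a b → a * b * (a + b) ≠ 0 → ∀ (N : ℕ) [NeZero N],
      (Literature.NumberTheory.EllipticCurves.freyCurve a b).conductorNorm ℤ = N →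
      ∀ D : Literature.NumberTheory.EllipticCurves.ModularForms.ModularParametrizationData
        (Literature.NumberTheory.EllipticCurves.freyCurve a b) N,
        (∀ D' : Literature.NumberTheory.EllipticCurves.ModularForms.ModularParametrizationData
          (Literature.NumberTheory.EllipticCurves.freyCurve a b) N, D.deg ≤ D'.deg) →
        ((D.deg / (ordProj[2] D.deg * ordProj[3] D.deg) : ℕ) : ℝ) ≤ C * (N : ℝ) ^ (2 + ε) := by
  sorry

/-- **Stub 3 — the valuation-product milestone** (verbatim stmt-ABC-1567 `AbcValuationProduct`; shared with route
RibetTakahashiSplit, closes there by `abcValuationProduct_of_many_few`). -/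
theorem stub_abcValuationProduct :
    ∀ ε : ℝ, 0 < ε → ∃ K : ℝ, ∀ a b c : ℕ, Literature.NumberTheory.DiophantineGeometry.IsABCTriple a b c →
      ((∏ p ∈ (a * b * c).primeFactors, (a * b * c).factorization p : ℕ) : ℝ) ≤
        K * ((Literature.NumberTheory.DiophantineGeometry.rad a b c : ℕ) : ℝ) ^ ε := by
  sorry

/-- **Composition**: the three stubs give the crux BY NAME — verbatim the LANDED split glue
`Summit.ABC.ABC.Theorems.steinbergCore_of_subs` (Theorems/DefiniteXiSteinbergCoreSplit.lean, p137293; the T-child is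
converted by the landed `Summit.ABC.ABC.Theorems.stub_allTamExp_of_valuationProduct`). -/
theorem SteinbergCore_of :
    (∀ ε : ℝ, 0 < ε → ∃ C : ℝ, ∀ a b : ℤ, IsCoprime a b → a * b * (a + b) ≠ 0 → ∀ (N : ℕ) [NeZero N],
      (Literature.NumberTheory.EllipticCurves.freyCurve a b).conductorNorm ℤ = N →
      ∀ Nm : ℕ, Odd Nm → Squarefree Nm → Odd Nm.primeFactors.card → Nm ∣ N →
      Literature.NumberTheory.Automorphic.brandtXi (N / Nm) Nm
          (fun n => (Literature.NumberTheory.EllipticCurves.freyCurve a b).LFunction n) ≠ 0 →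
      ∃ D : Literature.NumberTheory.EllipticCurves.ModularForms.ModularParametrizationData
        (Literature.NumberTheory.EllipticCurves.freyCurve a b) N,
        (∀ D' : Literature.NumberTheory.EllipticCurves.ModularForms.ModularParametrizationData
          (Literature.NumberTheory.EllipticCurves.freyCurve a b) N, D.deg ≤ D'.deg) ∧
        ((Literature.NumberTheory.Automorphic.brandtXi (N / Nm) Nm
              (fun n => (Literature.NumberTheory.EllipticCurves.freyCurve a b).LFunction n) /
            (ordProj[2] (Literature.NumberTheory.Automorphic.brandtXi (N / Nm) Nm
                (fun n => (Literature.NumberTheory.EllipticCurves.freyCurve a b).LFunction n)) *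
              ordProj[3] (Literature.NumberTheory.Automorphic.brandtXi (N / Nm) Nm
                (fun n => (Literature.NumberTheory.EllipticCurves.freyCurve a b).LFunction n))) : ℕ) : ℝ) ≤
          C * (N : ℝ) ^ ε * ((D.deg / (ordProj[2] D.deg * ordProj[3] D.deg) : ℕ) : ℝ) *
            ((∏ q ∈ N.primeFactors, ((Literature.NumberTheory.EllipticCurves.freyCurve a b).minimalDiscriminantNorm
              ℤ).factorization q : ℕ) : ℝ) ^ 3) →
    (∀ ε : ℝ, 0 < ε → ∃ C : ℝ, ∀ a b : ℤ, IsCoprime a b → a * b * (a + b) ≠ 0 → ∀ (N : ℕ) [NeZero N],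
      (Literature.NumberTheory.EllipticCurves.freyCurve a b).conductorNorm ℤ = N →
      ∀ D : Literature.NumberTheory.EllipticCurves.ModularForms.ModularParametrizationData
        (Literature.NumberTheory.EllipticCurves.freyCurve a b) N,
        (∀ D' : Literature.NumberTheory.EllipticCurves.ModularForms.ModularParametrizationData
          (Literature.NumberTheory.EllipticCurves.freyCurve a b) N, D.deg ≤ D'.deg) →
        ((D.deg / (ordProj[2] D.deg * ordProj[3] D.deg) : ℕ) : ℝ) ≤ C * (N : ℝ) ^ (2 + ε)) →
    (∀ ε : ℝ, 0 < ε → ∃ K : ℝ, ∀ a b c : ℕ, Literature.NumberTheory.DiophantineGeometry.IsABCTriple a b c →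
      ((∏ p ∈ (a * b * c).primeFactors, (a * b * c).factorization p : ℕ) : ℝ) ≤
        K * ((Literature.NumberTheory.DiophantineGeometry.rad a b c : ℕ) : ℝ) ^ ε) →
    Summit.ABC.ABC.Theses.DefiniteXi.SteinbergCore :=
  Summit.ABC.ABC.Theorems.steinbergCore_of_subs

/-- The crux from the registered stubs. -/
theorem steinbergCore : Summit.ABC.ABC.Theses.DefiniteXi.SteinbergCore :=
  SteinbergCore_of stub_xiDegreeComparison stub_primeToSixDegreeBound stub_abcValuationProduct

end

end Summit.ABC.ABC.Cruxes.SteinbergCore.P6TamagawaSplit
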